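import Summits.QuantumFields.BalabanUV.T4Continuum.Spine.NE3.PairAxialGaugeB8
import Summits.QuantumFields.BalabanUV.T4Continuum.Support.NE3FluxGradientDictionary
import Summits.QuantumFields.BalabanUV.T4Continuum.Support.NE3AveragedGradientRadius
import Summits.QuantumFields.BalabanUV.T4Continuum.Support.MinimalActionClassSix
import Literature.MathematicalPhysics.QuantumFieldTheory.Balaban1983to89.B8Ineq132
import HarnessLib

/-!
# T⁴ programme, node NE3 (pub-ymgap DAG node N16) — [B8] (1.33)∕(1.34), THE `𝔄_k`-CLAUSES, AT THE MINIMISER PAIR IN THE TREE's TYPED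
# VOCABULARY `B8Ineq132.InAk`: (1.7) plaquettes AND (1.9) currents `|(D^{η*}_U ∂U)(b)| < α₀L^{−2j}(Lʲη)⁻¹` for the background `W = rescale L (bavg L U_B)`
# and for the minimiser `U_A` (hence for `U_A^{u₀}`), from the sup-regularity letters of `U_A`, `U_B` ALONE (`PairClassAkB8`)

Cell `pub-ymgap`, HUMAN RULING D-0062, seat `pub-ymgap-dag-n16-b` (FIRST-MISSING-ESTIMATE for N16 = NE3; writer prover-pub-ymgap-dag-n16-b-g0-0,
2026-08-25).  Companion of `Spine/NE3/PairAxialGaugeB8` (the axial clause of (1.34) and (1.66) at the pair) and of the Literature modus ponens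
`Balaban1983to89.B8Thm4HypothesesPair.concl_of_thm4At_pair` ([B8] Theorem 4's typed interface `B8Eq119TwistedAxial.Thm4At` APPLIES at the
pair given `InAk` of both fields and `Reg U₀`): this file supplies the two `InAk` binders from row NE3's leaf data — `RegularSup d L N b c k U_A`
and `RegularSup d L N b c (k+1) U_B` (the (H3ˢᵘᵖ) leaf `LeafIndexSockets.LeafH3sup` = [B11] Thm 1 (8)+(10) TYPE, THE END's own hypothesis).

WHAT ([folklore]; 0 def, 0 sorry):
* §1 THE DICTIONARY «hol-gradient radius ⟹ (1.9)»: for a unitary `V` whose transported plaquette differences are `≤ x₁`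
  (`‖Ad_{V(p,μ)} V(∂p_{κν}(p + e_μ)) − V(∂p_{κν}(p))‖ ≤ x₁`, all `p, μ, κ ≠ ν` — row NE3's plaquette-gradient radius), lit-balaban's backward
  covariant derivative of the plaquette field is `≤ |η|⁻¹x₁` (`norm_covDeriv_plaqF_le`) and its (1.2) covariant divergence is `≤ (d − 1)|η|⁻¹x₁`
  (`norm_covDiv_le_of_plaqGrad`).
* §2 `inAk_of_radii`: `SmallField V a` with `a < α·L^{−2k}` and a plaquette-gradient radius `x₁` with `(d−1)·Lᵏ·x₁ < α·L^{−2k}` give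
  `InAk L k (Lᵏ)⁻¹ α Ω V` for EVERY region family `Ω` (at `η = L^{−k}` the level-`k` thresholds are the smallest, `B8Ineq132.thr_mono`).
* §3 AT THE PAIR (`inAk_pair`): from `RegularSup d L N b c k U_A` (flux-gradient letter `c`, via `NE3FluxGradientDictionary`: hol-gradient `2c∕(Lᵏ)³`) and
  `RegularSup d L N b c (k+1) U_B` + (Rb) (via `NE3AveragedGradientRadius`: hol-gradient of `W` is `2(c + curConst·b²)∕(Lᵏ)³`, plaquettes
  `(b + 226(8(d+1)(d+4))²b²)∕(Lᵏ)²`): `W, U_A ∈ 𝔄_k({Ω_j}, α)` in the form `InAk L k (Lᵏ)⁻¹ α Ω ·` for every `Ω` and every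
  `α > max (b + 226(8(d+1)(d+4))²b², 2(d−1)(c + curConst·b²))`; `inAk_gaugeAct_pair`: the same for `U_A^{u₀}`, any `{|u| ≤ 1}`-valued `u₀`
  (gauge invariance of `𝔄_k`, `B8Ineq132.inAk_gaugeAct_iff`).
PRINTED LOCI ([Balaban1985RegularSpaces] = B8): (1.1)–(1.2) p. 76 (covariant derivatives, the divergence `D^{η*}_U∂U`); (1.7)–(1.9) p. 77 (the class
`𝔄_k({Ω_j}, α₀)`); (1.33)–(1.34) p. 82; p. 77 «Thus the space 𝔄_k({Ω_j}, α₀) is invariant with respect to gauge transformations».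
[Balaban1985Variational] Thm 1 (8)–(10) p. 279 (the regularity TYPE of the minimisers).

HONEST FRAMING (page 1): a dictionary between two tree vocabularies + bookkeeping; the regularity data `RegularSup` of the minimisers is a
HYPOTHESIS (leaf (H3ˢᵘᵖ), [B11] Thm 1 TYPE, NOT proved); (1.33)'s clause «(3.35) of [4]» is NOT touched; Theorem 4 ∕ Theorem 2 ∕ NE3 NOT proved; spine
0∕9; finite T⁴ rung (B)+1 at fixed ε — NOT infinite volume, NOT mass gap, NOT `BetaPertH`, NOT Clay.  PLACEMENT: `Spine/NE3/`.
-/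

set_option autoImplicit false

open scoped BigOperators Matrix Matrix.Norms.L2Operator
open NormedSpace Finset

namespace Summit.QuantumFields.BalabanUV.T4Continuum.NE3.PairClassAkB8

open Literature.MathematicalPhysics.QuantumFieldTheory.Balaban1983to89
open B7Prop1Explicit B7Prop2Explicit
open B7Eq78Linearization (conjR)
open B8Ineq132 (plaqF covDeriv covDiv CondAt InAk thr_mono inAk_gaugeAct_iff)
open T4AveragingDeficitWall (IsUnitaryCfg SmallField Ad Plane flux covGrad)
open T4AveragingDeficitWallBoundary (IsPeriodicCfg)
open AveragingDeficitTransport (norm_Ad_of_unitary mem_U1_of_unitary)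
open MinimalActionSandwich (IsMinimiser)
open MinimalActionRate (Regular sfClass rescale_bavg_mem_sfClass)
open MinimalActionRefine (RegularSup)
open MinimalActionClassSix (conjR_eq_Ad)
open BlockAverageCurrent (curConst curConst_nonneg)
open NE3FluxGradientDictionary (norm_Ad_hol_sub_hol_le_of_fluxGrad)
open NE3AveragedGradientRadius (norm_plaqGrad_rescale_bavg_le_scaled)

noncomputable section

variable {d : ℕ} {n : Type*} [Fintype n] [DecidableEq n]

/-! ## §1 The dictionary: plaquette-gradient radius ⟹ (1.9) -/

/-- **lit-balaban's backward covariant derivative (1.1) of the plaquette field is controlled by row NE3's plaquette-gradient radius**: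
`‖(D^{η*}_{V,ν} V(∂p_{κμ}))(x)‖ ≤ |η|⁻¹·x₁` — indeed `R(V(x − e_ν, x))F(x − e_ν) − F(x) = Ad_{V(p,ν)}⁻¹[F(p) − Ad_{V(p,ν)}F(p + e_ν)]`, `p = x − e_ν`,
and `Ad` by a unitary is an isometry. [folklore] -/
theorem norm_covDeriv_plaqF_le {V : Site d → Fin d → (Matrix n n ℂ)ˣ} (hV : IsUnitaryCfg V) {x₁ : ℝ}
    (hG : ∀ (p : Site d) (μ : Fin d) {κ ν : Fin d}, κ ≠ ν →
      ‖Ad (V p μ) ((hol V (p + e μ) (plaqWord κ ν) : (Matrix n n ℂ)ˣ) : Matrix n n ℂ)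
        - ((hol V p (plaqWord κ ν) : (Matrix n n ℂ)ˣ) : Matrix n n ℂ)‖ ≤ x₁)
    (η : ℝ) (ν : Fin d) {κ μ : Fin d} (hκμ : κ ≠ μ) (x : Site d) :
    ‖covDeriv η V ν (plaqF V κ μ) x‖ ≤ |η|⁻¹ * x₁ := by
  set p : Site d := x - e ν with hp
  have hx : x = p + e ν := by rw [hp, sub_add_cancel]
  have hu : V p ν ∈ unitaryUnits (Matrix n n ℂ) := hV p ν
  -- `R(V(x − e_ν, x))F(p) − F(p + e_ν) = Ad_{V(p,ν)⁻¹}[F(p) − Ad_{V(p,ν)}F(p + e_ν)]`, read through the isometry `Ad_{V(p,ν)}`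
  have h1 : Ad (V p ν) (conjR (V p ν)⁻¹ (plaqF V κ μ p) - plaqF V κ μ (p + e ν))
      = plaqF V κ μ p - Ad (V p ν) (plaqF V κ μ (p + e ν)) := by
    simp only [Ad, conjR, plaqF, inv_inv, mul_sub, sub_mul, mul_assoc, Units.mul_inv_cancel_left, Units.mul_inv, mul_one]
  unfold covDeriv
  rw [← hp, hx, norm_smul, norm_inv, Real.norm_eq_abs, ← norm_Ad_of_unitary hu (conjR _ _ - _), h1, norm_sub_rev]
  exact mul_le_mul_of_nonneg_left (hG p ν hκμ) (by positivity)

/-- **(1.2) is controlled by the plaquette-gradient radius**: `‖(D^{η*}_V ∂V)_μ(x)‖ ≤ (d − 1)·|η|⁻¹·x₁` (the divergence sums the backward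
derivatives of the `d − 1` plaquette fields containing the bond). [folklore] -/
theorem norm_covDiv_le_of_plaqGrad (hd : 1 ≤ d) {V : Site d → Fin d → (Matrix n n ℂ)ˣ} (hV : IsUnitaryCfg V) {x₁ : ℝ}
    (hG : ∀ (p : Site d) (μ : Fin d) {κ ν : Fin d}, κ ≠ ν →
      ‖Ad (V p μ) ((hol V (p + e μ) (plaqWord κ ν) : (Matrix n n ℂ)ˣ) : Matrix n n ℂ)
        - ((hol V p (plaqWord κ ν) : (Matrix n n ℂ)ˣ) : Matrix n n ℂ)‖ ≤ x₁)
    (η : ℝ) (μ : Fin d) (x : Site d) :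
    ‖covDiv η V μ x‖ ≤ ((d : ℝ) - 1) * (|η|⁻¹ * x₁) := by
  unfold covDiv
  have h1 : ‖∑ ν ∈ Finset.Iio μ, covDeriv η V ν (plaqF V ν μ) x‖ ≤ (Finset.Iio μ).card • (|η|⁻¹ * x₁) :=
    (norm_sum_le _ _).trans (Finset.sum_le_card_nsmul _ _ _ fun ν hν =>
      norm_covDeriv_plaqF_le hV hG η ν (Finset.mem_Iio.mp hν).ne x)
  have h2 : ‖∑ ν ∈ Finset.Ioi μ, covDeriv η V ν (plaqF V μ ν) x‖ ≤ (Finset.Ioi μ).card • (|η|⁻¹ * x₁) :=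
    (norm_sum_le _ _).trans (Finset.sum_le_card_nsmul _ _ _ fun ν hν =>
      norm_covDeriv_plaqF_le hV hG η ν (Finset.mem_Ioi.mp hν).ne x)
  rw [nsmul_eq_mul] at h1 h2
  have hnat : (Finset.Iio μ).card + (Finset.Ioi μ).card = d - 1 := by
    rw [Fin.card_Iio, Fin.card_Ioi]; have := μ.isLt; omega
  have hcard : ((Finset.Iio μ).card : ℝ) + (Finset.Ioi μ).card = (d : ℝ) - 1 := by
    have h := congrArg (fun m : ℕ => (m : ℝ)) hnat
    simp only [Nat.cast_add] at h
    rw [h, Nat.cast_sub hd, Nat.cast_one]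
  calc ‖∑ ν ∈ Finset.Iio μ, covDeriv η V ν (plaqF V ν μ) x - ∑ ν ∈ Finset.Ioi μ, covDeriv η V ν (plaqF V μ ν) x‖
      ≤ (Finset.Iio μ).card * (|η|⁻¹ * x₁) + (Finset.Ioi μ).card * (|η|⁻¹ * x₁) := (norm_sub_le _ _).trans (add_le_add h1 h2)
    _ = ((d : ℝ) - 1) * (|η|⁻¹ * x₁) := by rw [← add_mul, hcard]

/-! ## §2 `𝔄_k` membership from the two radii -/

/-- **`V ∈ 𝔄_k({Ω_j}, α)` FROM THE TWO RADII**: a unitary `V` with `SmallField V a`, `a < α·L^{−2k}`, and a plaquette-gradient radius `x₁` with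
`(d − 1)·Lᵏ·x₁ < α·L^{−2k}` satisfies `InAk L k (Lᵏ)⁻¹ α Ω V` for EVERY family `Ω` — (1.7) and (1.9) at `η = L^{−k}` on every region of every
level (the level-`k` thresholds are the smallest, `B8Ineq132.thr_mono`). [folklore] -/
theorem inAk_of_radii (hd : 1 ≤ d) {L : ℕ} (hL : 1 ≤ L) (k : ℕ) {V : Site d → Fin d → (Matrix n n ℂ)ˣ} (hV : IsUnitaryCfg V) {a x₁ α : ℝ}
    (hα : 0 ≤ α) (hS : SmallField V a) (ha : a < α * (((L : ℝ) ^ k)⁻¹) ^ 2)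
    (hG : ∀ (p : Site d) (μ : Fin d) {κ ν : Fin d}, κ ≠ ν →
      ‖Ad (V p μ) ((hol V (p + e μ) (plaqWord κ ν) : (Matrix n n ℂ)ˣ) : Matrix n n ℂ)
        - ((hol V p (plaqWord κ ν) : (Matrix n n ℂ)ˣ) : Matrix n n ℂ)‖ ≤ x₁)
    (hx : ((d : ℝ) - 1) * ((L : ℝ) ^ k * x₁) < α * (((L : ℝ) ^ k)⁻¹) ^ 2) (Ω : ℕ → Set (Site d)) :
    InAk L k (((L : ℝ) ^ k)⁻¹) α Ω V := by
  have hL1 : (1 : ℝ) ≤ L := by exact_mod_cast hL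
  have hLk : (0 : ℝ) < (L : ℝ) ^ k := by positivity
  have hη : (0 : ℝ) < ((L : ℝ) ^ k)⁻¹ := by positivity
  have hηabs : |(((L : ℝ) ^ k)⁻¹)|⁻¹ = (L : ℝ) ^ k := by rw [abs_of_pos hη, inv_inv]
  have hone : (L : ℝ) ^ k * ((L : ℝ) ^ k)⁻¹ = 1 := mul_inv_cancel₀ hLk.ne'
  intro j hj
  obtain ⟨hm1, hm2⟩ := thr_mono (α := α) hL hα hη hj
  refine ⟨fun x μ ν hμν _ => ?_, fun x μ _ => ?_⟩
  · exact ((hS x μ ν hμν).trans_lt ha).trans_le hm1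
  · have h := norm_covDiv_le_of_plaqGrad hd hV hG (((L : ℝ) ^ k)⁻¹) μ x
    rw [hηabs] at h
    refine (h.trans_lt ?_).trans_le hm2
    rw [hone, inv_one, mul_one]
    linarith

/-- **Gauge invariance of `𝔄_k`** (p. 77) in row NE3's letters: for a unitary site gauge `u₀`, `InAk … (U^{u₀}) ↔ InAk … U`. [folklore] -/
theorem inAk_gaugeAct_iff' [Nonempty n] (L k : ℕ) (η α : ℝ) (Ω : ℕ → Set (Site d)) {u₀ : Site d → (Matrix n n ℂ)ˣ}
    (hu₀ : ∀ x, u₀ x ∈ unitaryUnits (Matrix n n ℂ)) (U : Site d → Fin d → (Matrix n n ℂ)ˣ) :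
    InAk L k η α Ω (gaugeAct u₀ U) ↔ InAk L k η α Ω U :=
  inAk_gaugeAct_iff L k η α Ω (fun x => mem_U1_of_unitary (hu₀ x)) U

/-! ## §3 At the minimiser pair -/

/-- **THE `𝔄_k`-CLAUSE OF (1.34) FOR THE MINIMISER `U_A`** from its sup-regularity letters: `RegularSup d L N b c k U_A`, `b∕(Lᵏ)² ≤ 1∕4`,
`b < α`, `4(d − 1)c < α` ⟹ `InAk L k (Lᵏ)⁻¹ α Ω U_A` for every `Ω` (hol-gradient radius `2c∕(Lᵏ)³` by `NE3FluxGradientDictionary`). [folklore] -/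
theorem inAk_of_regularSup (hd : 1 ≤ d) {L N : ℕ} (hL : 1 ≤ L) {k : ℕ} {U : Site d → Fin d → (Matrix n n ℂ)ˣ} {b c α : ℝ}
    (hreg : RegularSup d L N b c k U) (hb4 : b / ((L : ℝ) ^ k) ^ 2 ≤ 1 / 4) (hα : 0 ≤ α) (hbα : b < α)
    (hcα : 4 * ((d : ℝ) - 1) * c < α) (Ω : ℕ → Set (Site d)) :
    InAk L k (((L : ℝ) ^ k)⁻¹) α Ω U := by
  have hL1 : (1 : ℝ) ≤ L := by exact_mod_cast hL
  have hLk : (0 : ℝ) < (L : ℝ) ^ k := by positivity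
  have hLk1 : (1 : ℝ) ≤ (L : ℝ) ^ k := one_le_pow₀ hL1
  have hG : ∀ (p : Site d) (μ : Fin d) {κ ν : Fin d}, κ ≠ ν →
      ‖Ad (U p μ) ((hol U (p + e μ) (plaqWord κ ν) : (Matrix n n ℂ)ˣ) : Matrix n n ℂ)
        - ((hol U p (plaqWord κ ν) : (Matrix n n ℂ)ˣ) : Matrix n n ℂ)‖ ≤ 2 * (c / ((L : ℝ) ^ k) ^ 3) :=
    fun p μ κ ν hκν => norm_Ad_hol_sub_hol_le_of_fluxGrad hreg.unitary hreg.small hb4 hreg.grad p μ hκν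
  refine inAk_of_radii hd hL k hreg.unitary hα hreg.small ?_ hG ?_ Ω
  · rw [inv_pow, ← div_eq_mul_inv]
    exact div_lt_div_of_pos_right hbα (by positivity)
  · have hd1 : (0 : ℝ) ≤ (d : ℝ) - 1 := by
      have : (1 : ℝ) ≤ d := by exact_mod_cast hd
      linarith
    have e : ((d : ℝ) - 1) * ((L : ℝ) ^ k * (2 * (c / ((L : ℝ) ^ k) ^ 3))) = 2 * ((d : ℝ) - 1) * c * (((L : ℝ) ^ k)⁻¹) ^ 2 := by
      field_simp
    rw [e]
    have hη2 : (0 : ℝ) < (((L : ℝ) ^ k)⁻¹) ^ 2 := by positivity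
    have : 2 * ((d : ℝ) - 1) * c < α := by nlinarith
    exact mul_lt_mul_of_pos_right this hη2

/-- **THE `𝔄_k`-CLAUSE OF (1.33) FOR THE BACKGROUND `W = rescale L (bavg L U_B)`** from `U_B`'s sup-regularity letters at level `k + 1`:
`RegularSup d L N b c (k+1) U_B`, (Rb) `2¹⁵(d+1)²(d+4)²L²b ≤ 1`, `b + 226(8(d+1)(d+4))²b² < α`, `4(d − 1)(c + curConst·b²) < α`
⟹ `InAk L k (Lᵏ)⁻¹ α Ω W` for every `Ω` (plaquette radius by `MinimalActionRate.rescale_bavg_mem_sfClass`, hol-gradient radius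
`2(c + curConst·b²)∕(Lᵏ)³` by `NE3AveragedGradientRadius.norm_plaqGrad_rescale_bavg_le_scaled`). [folklore] -/
theorem inAk_rescale_bavg_of_regularSup [Nonempty n] (hd : 1 ≤ d) {L N : ℕ} (hL : 1 ≤ L) {k : ℕ} {UB : Site d → Fin d → (Matrix n n ℂ)ˣ} {b c α : ℝ}
    (hreg : RegularSup d L N b c (k + 1) UB) (hb : 0 ≤ b) (hc : 0 ≤ c)
    (hRb : 2 ^ 15 * ((d : ℝ) + 1) ^ 2 * ((d : ℝ) + 4) ^ 2 * (L : ℝ) ^ 2 * b ≤ 1) (hα : 0 ≤ α)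
    (hbα : b + 226 * (8 * (d + 1) * (d + 4)) ^ 2 * b ^ 2 < α) (hcα : 4 * ((d : ℝ) - 1) * (c + curConst d L * b ^ 2) < α)
    (Ω : ℕ → Set (Site d)) :
    InAk L k (((L : ℝ) ^ k)⁻¹) α Ω (rescale L (bavg L UB)) := by
  have hL1 : (1 : ℝ) ≤ L := by exact_mod_cast hL
  have hLk : (0 : ℝ) < (L : ℝ) ^ k := by positivity
  have hbs : 512 * (d + 1) * (d + 4) * (L : ℝ) ^ 2 * b ≤ 1 := by
    have h1 : (512 : ℝ) * (d + 1) * (d + 4) * (L : ℝ) ^ 2 * b ≤ 2 ^ 15 * ((d : ℝ) + 1) ^ 2 * ((d : ℝ) + 4) ^ 2 * (L : ℝ) ^ 2 * b := by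
      have hd0 : (0 : ℝ) ≤ d := Nat.cast_nonneg d
      have : (512 : ℝ) * (d + 1) * (d + 4) ≤ 2 ^ 15 * ((d : ℝ) + 1) ^ 2 * ((d : ℝ) + 4) ^ 2 := by nlinarith
      have hL2b : 0 ≤ (L : ℝ) ^ 2 * b := by positivity
      nlinarith
    linarith
  have hreg' : Regular d L N b (MinimalActionRefine.gradConst d c) (k + 1) UB := hreg.regular
  obtain ⟨hWu, -, hWsm⟩ := rescale_bavg_mem_sfClass hL hb hbs le_rfl hreg'
  have hG : ∀ (p : Site d) (μ : Fin d) {κ ν : Fin d}, κ ≠ ν →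
      ‖Ad (rescale L (bavg L UB) p μ) ((hol (rescale L (bavg L UB)) (p + e μ) (plaqWord κ ν) : (Matrix n n ℂ)ˣ) : Matrix n n ℂ)
        - ((hol (rescale L (bavg L UB)) p (plaqWord κ ν) : (Matrix n n ℂ)ˣ) : Matrix n n ℂ)‖ ≤ 2 * (c + curConst d L * b ^ 2) / ((L : ℝ) ^ k) ^ 3 :=
    fun p μ κ ν hκν => norm_plaqGrad_rescale_bavg_le_scaled hL hreg.unitary hb hRb hreg.small hreg.grad p μ hκν
  refine inAk_of_radii hd hL k hWu hα hWsm ?_ hG ?_ Ω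
  · rw [inv_pow, ← div_eq_mul_inv]
    exact div_lt_div_of_pos_right hbα (by positivity)
  · have hd1 : (0 : ℝ) ≤ (d : ℝ) - 1 := by
      have : (1 : ℝ) ≤ d := by exact_mod_cast hd
      linarith
    have hcc : 0 ≤ c + curConst d L * b ^ 2 := by have := curConst_nonneg (d := d) L; positivity
    have e : ((d : ℝ) - 1) * ((L : ℝ) ^ k * (2 * (c + curConst d L * b ^ 2) / ((L : ℝ) ^ k) ^ 3))
        = 2 * ((d : ℝ) - 1) * (c + curConst d L * b ^ 2) * (((L : ℝ) ^ k)⁻¹) ^ 2 := by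
      field_simp
    rw [e]
    have hη2 : (0 : ℝ) < (((L : ℝ) ^ k)⁻¹) ^ 2 := by positivity
    have : 2 * ((d : ℝ) - 1) * (c + curConst d L * b ^ 2) < α := by nlinarith
    exact mul_lt_mul_of_pos_right this hη2

/-- **(1.33)∕(1.34), THE `𝔄_k`-CLAUSES, AT THE MINIMISER PAIR**: for `U_A` a run-`k` minimiser and `U_B` a `(b, c)`-sup-regular run-`(k+1)`
minimiser over `sfClass d L N ε` with the same datum, `U_A` `(b, c)`-sup-regular at level `k` (both regularities = the leaf (H3ˢᵘᵖ)), the lines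
`b∕(Lᵏ)² ≤ 1∕4`, (Rb), and `α` above the four radii: `W = rescale L (bavg L U_B)`, `U_A` and — for every unitary site gauge `u₀`, in particular
the pinned axial pre-gauge of `PairAxialGaugeB8.exists_pairAxialGauge` — `U_A^{u₀}` all lie in `𝔄_k({Ω_j}, α)` at `η = L^{−k}`, for every `Ω`.
Together with `PairAxialGaugeB8` (axial clause + (1.66)) these are ALL hypotheses of [B8] Theorem 4 at the pair except «(3.35) of [4]» for `W`
(`B8Thm4HypothesesPair.concl_of_thm4At_pair`). [folklore] -/
theorem inAk_pair [Nonempty n] (hd : 1 ≤ d) {L N : ℕ} (hL : 1 ≤ L) {k : ℕ} {ε b c α : ℝ}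
    {V UA UB : Site d → Fin d → (Matrix n n ℂ)ˣ}
    (_hA : IsMinimiser d (sfClass d L N ε) L N k V UA) (_hB : IsMinimiser d (sfClass d L N ε) L N (k + 1) V UB)
    (hregA : RegularSup d L N b c k UA) (hregB : RegularSup d L N b c (k + 1) UB) (hb : 0 ≤ b) (hc : 0 ≤ c)
    (hb4 : b / ((L : ℝ) ^ k) ^ 2 ≤ 1 / 4) (hRb : 2 ^ 15 * ((d : ℝ) + 1) ^ 2 * ((d : ℝ) + 4) ^ 2 * (L : ℝ) ^ 2 * b ≤ 1) (hα : 0 ≤ α)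
    (hbα : b + 226 * (8 * (d + 1) * (d + 4)) ^ 2 * b ^ 2 < α) (hcα : 4 * ((d : ℝ) - 1) * (c + curConst d L * b ^ 2) < α)
    (Ω : ℕ → Set (Site d)) {u₀ : Site d → (Matrix n n ℂ)ˣ} (hu₀ : ∀ x, u₀ x ∈ unitaryUnits (Matrix n n ℂ)) :
    InAk L k (((L : ℝ) ^ k)⁻¹) α Ω (rescale L (bavg L UB)) ∧ InAk L k (((L : ℝ) ^ k)⁻¹) α Ω UA ∧
      InAk L k (((L : ℝ) ^ k)⁻¹) α Ω (gaugeAct u₀ UA) := by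
  have hbα' : b < α := by
    have : 0 ≤ 226 * (8 * ((d : ℝ) + 1) * (d + 4)) ^ 2 * b ^ 2 := by positivity
    linarith
  have hcα' : 4 * ((d : ℝ) - 1) * c < α := by
    have hd1 : (0 : ℝ) ≤ (d : ℝ) - 1 := by
      have : (1 : ℝ) ≤ d := by exact_mod_cast hd
      linarith
    have : 0 ≤ 4 * ((d : ℝ) - 1) * (curConst d L * b ^ 2) := by have := curConst_nonneg (d := d) L; positivity
    nlinarith
  have hA := inAk_of_regularSup hd hL hregA hb4 hα hbα' hcα' Ω
  exact ⟨inAk_rescale_bavg_of_regularSup hd hL hregB hb hc hRb hα hbα hcα Ω, hA, (inAk_gaugeAct_iff' L k _ α Ω hu₀ UA).2 hA⟩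

end

end Summit.QuantumFields.BalabanUV.T4Continuum.NE3.PairClassAkB8
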